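import Literature.NumberTheory.Sieve.CFSemigroupBowen
import Literature.NumberTheory.Sieve.CFSemigroupSections
import HarnessLib

/-!
# Hensley's bound: `#{γ ∈ Γ_A : ‖γ‖ ≤ R} ≍ R^{2δ_A}`

Support file (all results proved) for the named fact
`Literature.NumberTheory.Sieve.MageeOhWinter2019_uniformCounting` (`CFSemigroupCounting.lean`),
whose `q = 1` case asserts `#{γ ∈ Γ_A : ‖γ‖_F ≤ R} = c R^{2δ_A} + O(R^{2δ_A - ε})`. Here we prove
the ORDER OF MAGNITUDE of this count (Hensley): there are `c₁, c₂, R₀ > 0` with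
`c₁ R^{2δ_A} ≤ #{γ ∈ Γ_A : ‖γ‖_F ≤ R} ≤ c₂ R^{2δ_A}` (`R ≥ R₀`; the upper bound for all `R ≥ 1`),
`δ_A = cfDimension A` being the Hausdorff dimension of the limit set (`= dim_H E_A`, the zero of
the pressure: `CFSemigroupBowen.lean`). Ingredients:

* `cfWord_injective`: the word matrix `g_{a₁} ⋯ g_{aₙ}` determines `(n; a₁, …, aₙ)` (freeness of
  the semigroup on the `g_a`, [MageeOhWinter2019, §2.1 II] "the `g_a` generate a free semigroup"),
  via the column sums `(x, y) = (1,1) M`, which satisfy `0 < x ≤ y` and `(x, y) g_a = (y, x + a y)`;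
* `normSq_cfWord_le`, `sq_cfDen_le_normSq`: `q² ≤ ‖M_w‖_F² ≤ 4 q²` (`q = q(w)`);
* the section counts `4^{-δ} X^{2δ} ≤ #S_X ≤ 16^δ ((B+1)X)^{2δ}` of `CFSemigroupSections.lean`
  at `s = δ_A` (Gibbs bounds `1 ≤ Z_n(δ_A) ≤ 4^{δ_A}`), a dyadic decomposition
  `{w : q(w) ≤ R} ↪ ⊔_j S_{R/2^j}`, `w ↦ w b` (`b = max A ≥ 2`), for the upper bound, and the
  injection `S_X ↪ {γ ∈ Γ_A : ‖γ‖ ≤ R}`, `X = R/(2(B+1)²)` (padding odd words by one letter) for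
  the lower bound.

Main results: `cfCount_one_le` (upper), `le_cfCount_one` (lower), `cfCount_one_asymp`.

## References

* D. Hensley, *The distribution of badly approximable rationals and continuants with bounded
  digits. II*, J. Number Theory 34 (1990) 293–334, Thm. 1.
* M. Magee, H. Oh, D. Winter, J. reine angew. Math. 753 (2019) 89–135, Thm. 2 / Thm. 11 (the
  asymptotic refinement), §2.1 II. [MageeOhWinter2019]
* J. Bourgain, A. Kontorovich, *On Zaremba's conjecture*, Ann. of Math. 180 (2014) 137–196, (1.12).
-/

noncomputable section

open Filter Set
open scoped Classical MatrixGroups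

namespace Literature.NumberTheory.Sieve

/-! ### Freeness: the word matrix determines the word -/

variable {d : ℕ → ℕ}

/-- Column sums `x_n = M₀₀ + M₁₀`, `y_n = M₀₁ + M₁₁` of the word matrix satisfy `0 < x_n ≤ y_n`
(`(x_{n+1}, y_{n+1}) = (y_n, x_n + a_n y_n)`). [folklore] -/
theorem cfWord_colsum (hd : ∀ i, 1 ≤ d i) : ∀ n : ℕ,
    0 < cfWord d n 0 0 + cfWord d n 1 0 ∧
      cfWord d n 0 0 + cfWord d n 1 0 ≤ cfWord d n 0 1 + cfWord d n 1 1
  | 0 => by simp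
  | n + 1 => by
      obtain ⟨h1, h2⟩ := cfWord_colsum hd n
      have ha : (1 : ℤ) ≤ d n := by exact_mod_cast hd n
      rw [cfWord_succ_00, cfWord_succ_10, cfWord_succ_01, cfWord_succ_11]
      have hy : 0 < cfWord d n 0 1 + cfWord d n 1 1 := lt_of_lt_of_le h1 h2
      refine ⟨hy, ?_⟩
      nlinarith [mul_le_mul_of_nonneg_left ha hy.le]

/-- **Freeness of the word matrices.** If `M_n(d) = M_{n'}(d')` (digits `≥ 1`) then `n = n'` and
the digits agree below `n`: the `g_a`, `a ≥ 1`, generate a free semigroup, freely.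
[cite: MageeOhWinter2019, §2.1 II] -/
theorem cfWord_injective {d d' : ℕ → ℕ} (hd : ∀ i, 1 ≤ d i) (hd' : ∀ i, 1 ≤ d' i) :
    ∀ {n n' : ℕ}, cfWord d n = cfWord d' n' → n = n' ∧ ∀ i < n, d i = d' i
  | 0, 0, _ => ⟨rfl, fun i hi => absurd hi (Nat.not_lt_zero i)⟩
  | 0, n' + 1, h => by
      exfalso
      have e01 := congrFun (congrFun h 0) 1
      have e11 := congrFun (congrFun h 1) 1
      rw [cfWord_succ_01] at e01
      rw [cfWord_succ_11] at e11
      simp only [cfWord_zero, Matrix.one_apply_ne, ne_eq, zero_ne_one, not_false_eq_true,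
        Matrix.one_apply_eq] at e01 e11
      obtain ⟨h1, h2⟩ := cfWord_colsum hd' n'
      have ha : (1 : ℤ) ≤ d' n' := by exact_mod_cast hd' n'
      have hy : 0 < cfWord d' n' 0 1 + cfWord d' n' 1 1 := lt_of_lt_of_le h1 h2
      nlinarith [mul_le_mul_of_nonneg_left ha hy.le]
  | n + 1, 0, h => by
      exfalso
      have e01 := congrFun (congrFun h 0) 1
      have e11 := congrFun (congrFun h 1) 1
      rw [cfWord_succ_01] at e01
      rw [cfWord_succ_11] at e11
      simp only [cfWord_zero, Matrix.one_apply_ne, ne_eq, zero_ne_one, not_false_eq_true,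
        Matrix.one_apply_eq] at e01 e11
      obtain ⟨h1, h2⟩ := cfWord_colsum hd n
      have ha : (1 : ℤ) ≤ d n := by exact_mod_cast hd n
      have hy : 0 < cfWord d n 0 1 + cfWord d n 1 1 := lt_of_lt_of_le h1 h2
      nlinarith [mul_le_mul_of_nonneg_left ha hy.le]
  | n + 1, n' + 1, h => by
      have e00 := congrFun (congrFun h 0) 0
      have e01 := congrFun (congrFun h 0) 1
      have e10 := congrFun (congrFun h 1) 0
      have e11 := congrFun (congrFun h 1) 1
      rw [cfWord_succ_00, cfWord_succ_00] at e00
      rw [cfWord_succ_01, cfWord_succ_01] at e01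
      rw [cfWord_succ_10, cfWord_succ_10] at e10
      rw [cfWord_succ_11, cfWord_succ_11] at e11
      obtain ⟨h1, h2⟩ := cfWord_colsum hd n
      obtain ⟨h1', h2'⟩ := cfWord_colsum hd' n'
      have hy : 0 < cfWord d n 0 1 + cfWord d n 1 1 := lt_of_lt_of_le h1 h2
      have hyy : cfWord d n 0 1 + cfWord d n 1 1 = cfWord d' n' 0 1 + cfWord d' n' 1 1 := by
        rw [e00, e10]
      -- the last digits agree
      have haa : (d n : ℤ) = d' n' := by
        by_contra hne
        rcases lt_or_gt_of_ne hne with hlt | hlt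
        · have hle : (d n : ℤ) + 1 ≤ d' n' := hlt
          have := mul_le_mul_of_nonneg_left hle hy.le
          nlinarith
        · have hle : (d' n' : ℤ) + 1 ≤ d n := hlt
          have := mul_le_mul_of_nonneg_left hle hy.le
          nlinarith
      have hdd : d n = d' n' := by exact_mod_cast haa
      have hM : cfWord d n = cfWord d' n' := by
        ext i j
        fin_cases i <;> fin_cases j
        · simp only [Fin.zero_eta]
          rw [haa, e00] at e01
          linarith
        · exact e00
        · simp only [Fin.mk_one, Fin.zero_eta]
          rw [haa, e10] at e11
          linarith
        · exact e10
      obtain ⟨hn, hdig⟩ := cfWord_injective hd hd' hM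
      subst hn
      refine ⟨rfl, fun i hi => ?_⟩
      rcases Nat.lt_succ_iff_lt_or_eq.1 hi with hi | rfl
      · exact hdig i hi
      · exact hdd

/-! ### Frobenius norm versus continuant -/

/-- Every entry of a nonempty word matrix is at most its continuant `q = M₁₁`. [folklore] -/
theorem cfWord_apply_le_cfDen (hd : ∀ i, 1 ≤ d i) (m : ℕ) (i j : Fin 2) :
    cfWord d (m + 1) i j ≤ cfDen d (m + 1) := by
  have h10 := cfWord_10_le_cfDen hd (m + 1)
  fin_cases i <;> fin_cases j
  · exact (cfWord_fst_le_snd hd m).1.trans h10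
  · exact cfNum_le_cfDen hd (m + 1)
  · exact h10
  · exact le_rfl

/-- `‖M_w‖_F² ≤ 4 q(w)²` for a nonempty word. [folklore] -/
theorem normSq_cfWord_le (hd : ∀ i, 1 ≤ d i) (m : ℕ) :
    (∑ i, ∑ j, ((cfWord d (m + 1) i j : ℤ) : ℝ) ^ 2) ≤ 4 * ((cfDen d (m + 1) : ℤ) : ℝ) ^ 2 := by
  have hle : ∀ i j, ((cfWord d (m + 1) i j : ℤ) : ℝ) ^ 2 ≤ ((cfDen d (m + 1) : ℤ) : ℝ) ^ 2 := by
    intro i j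
    have h0 : (0 : ℝ) ≤ ((cfWord d (m + 1) i j : ℤ) : ℝ) := by exact_mod_cast cfWord_nonneg d _ i j
    have h1 : ((cfWord d (m + 1) i j : ℤ) : ℝ) ≤ ((cfDen d (m + 1) : ℤ) : ℝ) := by
      exact_mod_cast cfWord_apply_le_cfDen hd m i j
    exact pow_le_pow_left₀ h0 h1 2
  simp only [Fin.sum_univ_two]
  linarith [hle 0 0, hle 0 1, hle 1 0, hle 1 1]

/-- `q(w)² ≤ ‖M_w‖_F²`. [folklore] -/
theorem sq_cfDen_le_normSq (d : ℕ → ℕ) (n : ℕ) :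
    ((cfDen d n : ℤ) : ℝ) ^ 2 ≤ ∑ i, ∑ j, ((cfWord d n i j : ℤ) : ℝ) ^ 2 := by
  simp only [Fin.sum_univ_two, cfDen]
  nlinarith [sq_nonneg (((cfWord d n 0 0 : ℤ) : ℝ)), sq_nonneg (((cfWord d n 0 1 : ℤ) : ℝ)),
    sq_nonneg (((cfWord d n 1 0 : ℤ) : ℝ))]

/-- Each entry is bounded by the Frobenius norm: `M_{ij}² ≤ ‖M‖_F²`. [folklore] -/
theorem sq_apply_le_normSq (M : Matrix (Fin 2) (Fin 2) ℤ) (i j : Fin 2) :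
    ((M i j : ℤ) : ℝ) ^ 2 ≤ ∑ i, ∑ j, ((M i j : ℤ) : ℝ) ^ 2 := by
  have h00 := sq_nonneg (((M 0 0 : ℤ) : ℝ))
  have h01 := sq_nonneg (((M 0 1 : ℤ) : ℝ))
  have h10 := sq_nonneg (((M 1 0 : ℤ) : ℝ))
  have h11 := sq_nonneg (((M 1 1 : ℤ) : ℝ))
  simp only [Fin.sum_univ_two]
  fin_cases i <;> fin_cases j <;> simp <;> linarith

/-! ### The counted set at level `q = 1` -/

variable {A : Finset ℕ}

/-- The set counted by `cfCount A 1 1 R`: elements of `Γ_A` in the Frobenius ball of radius `R`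
(the congruence condition mod `1` is vacuous). [cite: MageeOhWinter2019, §1] -/
def cfBall (A : Finset ℕ) (R : ℝ) : Set SL(2, ℤ) :=
  {γ | (γ : Matrix (Fin 2) (Fin 2) ℤ) ∈ cfSemigroup A ∧
    (∑ i, ∑ j, (((γ : Matrix (Fin 2) (Fin 2) ℤ) i j : ℤ) : ℝ) ^ 2) ≤ R ^ 2 ∧
    Matrix.SpecialLinearGroup.map (Int.castRingHom (ZMod 1)) γ = 1}

/-- `cfCount A 1 1 R = #cfBall A R`. [folklore] -/
theorem cfCount_one_eq (A : Finset ℕ) (R : ℝ) : cfCount A 1 1 R = (cfBall A R).ncard := rfl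

/-- The congruence condition mod `1` is vacuous. [folklore] -/
theorem map_zmod_one_eq_one (γ : SL(2, ℤ)) :
    Matrix.SpecialLinearGroup.map (Int.castRingHom (ZMod 1)) γ = 1 := by
  haveI : Subsingleton (SL(2, ZMod 1)) := ⟨fun a b => Subtype.ext (Subsingleton.elim _ _)⟩
  exact Subsingleton.elim _ _

/-- The counted set is finite (entries are bounded by `R`). [folklore] -/
theorem cfBall_finite (A : Finset ℕ) (R : ℝ) : (cfBall A R).Finite := by
  have hfin : (Set.pi univ fun _ : Fin 2 => Set.pi univ fun _ : Fin 2 => Icc (-⌈|R|⌉) ⌈|R|⌉ :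
      Set (Fin 2 → Fin 2 → ℤ)).Finite :=
    Set.Finite.pi fun _ => Set.Finite.pi fun _ => Set.finite_Icc _ _
  refine (hfin.preimage (f := fun γ : SL(2, ℤ) =>
    ((γ : Matrix (Fin 2) (Fin 2) ℤ) : Fin 2 → Fin 2 → ℤ)) Subtype.val_injective.injOn).subset ?_
  rintro γ ⟨-, hnorm, -⟩
  rw [mem_preimage]
  refine Set.mem_univ_pi.2 fun i => Set.mem_univ_pi.2 fun j => ?_
  rw [mem_Icc]
  have hsq := (sq_apply_le_normSq (γ : Matrix (Fin 2) (Fin 2) ℤ) i j).trans hnorm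
  have habs : |(((γ : Matrix (Fin 2) (Fin 2) ℤ) i j : ℤ) : ℝ)| ≤ |R| := sq_le_sq.1 hsq
  have hR : |R| ≤ ((⌈|R|⌉ : ℤ) : ℝ) := Int.le_ceil _
  have h := abs_le.1 (habs.trans hR)
  exact ⟨by exact_mod_cast h.1, by exact_mod_cast h.2⟩

/-! ### From elements of `Γ_A` to words: the upper bound -/

/-- Every element of `Γ_A` is the word matrix of a nonempty word over `A`. [folklore] -/
theorem exists_sigma_of_mem_cfSemigroup {M : Matrix (Fin 2) (Fin 2) ℤ} (hM : M ∈ cfSemigroup A) :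
    ∃ x : Σ n : ℕ, Fin n → A, 1 ≤ x.1 ∧ cfMat (fun i => (x.2 i : ℕ)) = M := by
  obtain ⟨d, -, m, hdA, rfl⟩ := exists_eq_cfWord_of_mem_cfSemigroup' hM
  refine ⟨⟨m + 1, fun i => ⟨d i, hdA i i.2⟩⟩, Nat.succ_pos m, ?_⟩
  exact cfWord_congr fun i hi => by rw [cfExt_of_lt _ hi]

/-- A word attached to an element of `SL₂(ℤ)` (a genuine generating word when the element lies
in `Γ_A`, the empty word otherwise). [folklore] -/
def cfWordOf (A : Finset ℕ) (γ : SL(2, ℤ)) : Σ n : ℕ, Fin n → A :=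
  if h : (γ : Matrix (Fin 2) (Fin 2) ℤ) ∈ cfSemigroup A then
    (exists_sigma_of_mem_cfSemigroup h).choose else ⟨0, Fin.elim0⟩

/-- The attached word generates the element. [folklore] -/
theorem cfMat_cfWordOf {γ : SL(2, ℤ)} (h : (γ : Matrix (Fin 2) (Fin 2) ℤ) ∈ cfSemigroup A) :
    1 ≤ (cfWordOf A γ).1 ∧ cfMat (fun i => ((cfWordOf A γ).2 i : ℕ)) = γ := by
  rw [cfWordOf, dif_pos h]
  exact (exists_sigma_of_mem_cfSemigroup h).choose_spec

/-- The words of length `≤ N` with continuant `≤ R`. [folklore] -/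
def cfWordsLE (A : Finset ℕ) (N : ℕ) (R : ℝ) : Finset (Σ n : ℕ, Fin n → A) :=
  (Finset.range (N + 1)).sigma fun n =>
    Finset.univ.filter fun w : Fin n → A => ((cfQ fun i => (w i : ℕ)) : ℝ) ≤ R

/-- Membership in `cfWordsLE`. [folklore] -/
theorem mem_cfWordsLE {N : ℕ} {R : ℝ} {x : Σ n : ℕ, Fin n → A} :
    x ∈ cfWordsLE A N R ↔ x.1 ≤ N ∧ ((cfQ fun i => (x.2 i : ℕ)) : ℝ) ≤ R := by
  simp [cfWordsLE]

/-- **The count is at most the number of short words:** `#cfBall A R ≤ #cfWordsLE A N R` as soon as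
`R² < 2^N`. [folklore] -/
theorem ncard_cfBall_le_card (hA : ∀ a ∈ A, 1 ≤ a) {R : ℝ} (hR : 0 ≤ R) {N : ℕ}
    (hN : R ^ 2 < (2 : ℝ) ^ N) : (cfBall A R).ncard ≤ (cfWordsLE A N R).card := by
  rw [← Set.ncard_coe_finset]
  refine Set.ncard_le_ncard_of_injOn (cfWordOf A) (fun γ hγ => ?_) (fun γ hγ γ' hγ' h => ?_)
  · obtain ⟨hmem, hnorm, -⟩ := hγ
    obtain ⟨h1, hmat⟩ := cfMat_cfWordOf hmem
    rw [Finset.mem_coe, mem_cfWordsLE]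
    set x := cfWordOf A γ with hx
    have hw1 : ∀ i, 1 ≤ (fun i => ((x.2 i : A) : ℕ)) i := one_le_coe_digit hA x.2
    obtain ⟨m, hm⟩ : ∃ m, x.1 = m + 1 := Nat.exists_eq_succ_of_ne_zero (by omega)
    -- `q² ≤ ‖γ‖² ≤ R²`
    have hq : (((cfQ fun i => (x.2 i : ℕ)) : ℤ) : ℝ) ^ 2 ≤ R ^ 2 := by
      have h := sq_cfDen_le_normSq (cfExt fun i => ((x.2 i : A) : ℕ)) x.1
      have hmat' : cfWord (cfExt fun i => ((x.2 i : A) : ℕ)) x.1 = (γ : Matrix (Fin 2) (Fin 2) ℤ) :=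
        hmat
      rw [hmat'] at h
      exact h.trans hnorm
    have hq0 : (0 : ℝ) ≤ ((cfQ fun i => (x.2 i : ℕ)) : ℝ) := by
      exact_mod_cast (zero_le_one.trans (one_le_cfQ hw1))
    refine ⟨?_, ?_⟩
    · -- `2^{n-1} ≤ q² ≤ R² < 2^N`
      have hgrow : ((2 : ℤ) ^ (x.1 - 1) : ℝ) ≤ (((cfQ fun i => (x.2 i : ℕ)) : ℤ) : ℝ) ^ 2 := by
        exact_mod_cast pow_le_cfQ_sq hw1
      push_cast at hgrow
      have hlt : (2 : ℝ) ^ (x.1 - 1) < (2 : ℝ) ^ N := by linarith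
      have := (pow_lt_pow_iff_right₀ (by norm_num : (1 : ℝ) < 2)).1 hlt
      omega
    · exact (pow_le_pow_iff_left₀ hq0 hR two_ne_zero).1 (by exact_mod_cast hq)
  · obtain ⟨hmem, -, -⟩ := hγ
    obtain ⟨hmem', -, -⟩ := hγ'
    have h1 := (cfMat_cfWordOf hmem).2
    have h2 := (cfMat_cfWordOf hmem').2
    rw [h] at h1
    exact Subtype.ext (h1.symm.trans h2)

/-! ### The dyadic decomposition: counting short words by sections -/

/-- The dyadic scale `j(w) = min {j : R/2^{j+1} < q(w)}` of a word with `q(w) ≥ 1`, `R ≥ 0`.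
[folklore] -/
theorem exists_dyadic {R q : ℝ} (hq : 1 ≤ q) : ∃ j : ℕ, R / 2 ^ (j + 1) < q := by
  obtain ⟨j, hj⟩ := pow_unbounded_of_one_lt R (by norm_num : (1 : ℝ) < 2)
  refine ⟨j, ?_⟩
  rw [div_lt_iff₀ (by positivity), pow_succ]
  nlinarith [pow_pos (by norm_num : (0 : ℝ) < 2) j]

/-- Appending the letter `b` to a word. [folklore] -/
theorem cfDig_snoc_of_lt {n : ℕ} (w : Fin n → A) (b : A) {i : ℕ} (hi : i < n) :
    cfDig (Fin.snoc w b : Fin (n + 1) → A) i = cfDig w i := by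
  rw [cfDig_of_lt _ (Nat.lt_succ_of_lt hi), cfDig_of_lt _ hi]
  have : (⟨i, Nat.lt_succ_of_lt hi⟩ : Fin (n + 1)) = Fin.castSucc ⟨i, hi⟩ := rfl
  rw [this, Fin.snoc_castSucc]

/-- The appended letter is the digit at place `n`. [folklore] -/
theorem cfDig_snoc_self {n : ℕ} (w : Fin n → A) (b : A) :
    cfDig (Fin.snoc w b : Fin (n + 1) → A) n = (b : ℕ) := by
  rw [cfDig_of_lt _ (Nat.lt_succ_self n)]
  have : (⟨n, Nat.lt_succ_self n⟩ : Fin (n + 1)) = Fin.last n := rfl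
  rw [this, Fin.snoc_last]

/-- `q(w b) ≥ b q(w)`. [folklore] -/
theorem mul_cfQk_le_cfQk_snoc {n : ℕ} (w : Fin n → A) (b : A) :
    (b : ℤ) * cfQk w n ≤ cfQk (Fin.snoc w b : Fin (n + 1) → A) (n + 1) := by
  have hagree : ∀ i < n, cfDig (Fin.snoc w b : Fin (n + 1) → A) i = cfDig w i :=
    fun i hi => cfDig_snoc_of_lt w b hi
  have hq : cfQk (Fin.snoc w b : Fin (n + 1) → A) n = cfQk w n := cfQk_eq_of_agree hagree le_rfl
  simp only [cfQk] at hq ⊢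
  rw [cfDen_succ, ← hq]
  have h10 : 0 ≤ cfWord (cfDig (Fin.snoc w b : Fin (n + 1) → A)) n 1 0 := cfWord_nonneg _ _ 1 0
  have hb : (cfDig (Fin.snoc w b : Fin (n + 1) → A) n : ℤ) = (b : ℕ) := by
    rw [cfDig_snoc_self]
  rw [hb]
  nlinarith

section Dyadic

variable (hA : ∀ a ∈ A, 1 ≤ a) (h2 : 2 ≤ A.card)
include hA h2

/-- `max A ≥ 2` when `A ⊆ ℕ_{≥1}` has two elements. [folklore] -/
theorem two_le_max' : 2 ≤ A.max' (nonempty_of_two_le_card h2) := by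
  by_contra hlt
  push Not at hlt
  have hsub : A ⊆ {1} := fun a ha => by
    have h1 := hA a ha
    have h2' := A.le_max' a ha
    rw [Finset.mem_singleton]
    omega
  have := Finset.card_le_card hsub
  rw [Finset.card_singleton] at this
  omega

/-- **The short words inject into dyadic sections:** for `R ≥ 1`,
`#cfWordsLE A N R ≤ Σ_{j ≤ log₂ R} #S_{R/2^j}^{≤ N+1}`. [folklore] -/
theorem card_cfWordsLE_le_sum (N : ℕ) {R : ℝ} (hR : 1 ≤ R) :
    ((cfWordsLE A N R).card : ℝ) ≤
      ∑ j ∈ Finset.range (Nat.log 2 ⌊R⌋₊ + 1), ((cfSec A (R / 2 ^ j) (N + 1)).card : ℝ) := by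
  have hne := nonempty_of_two_le_card h2
  set b : A := ⟨A.max' hne, A.max'_mem hne⟩ with hb
  have hb2 : 2 ≤ (b : ℕ) := two_le_max' hA h2
  -- the dyadic scale of a word
  have hq1 : ∀ {n : ℕ} (w : Fin n → A), (1 : ℝ) ≤ (cfQk w n : ℝ) := fun w => by
    exact_mod_cast one_le_cfQk hA w _
  let jOf : (Σ n : ℕ, Fin n → A) → ℕ := fun x => Nat.find (exists_dyadic (R := R) (hq1 x.2))
  have hj1 : ∀ x : Σ n : ℕ, Fin n → A, R / 2 ^ (jOf x + 1) < (cfQk x.2 x.1 : ℝ) := fun x =>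
    Nat.find_spec (exists_dyadic (R := R) (hq1 x.2))
  have hj2 : ∀ x : Σ n : ℕ, Fin n → A, (cfQk x.2 x.1 : ℝ) ≤ R → (cfQk x.2 x.1 : ℝ) ≤ R / 2 ^ jOf x := by
    intro x hx
    rcases Nat.eq_zero_or_pos (jOf x) with h0 | hpos
    · rw [h0, pow_zero, div_one]; exact hx
    · obtain ⟨j', hj'⟩ := Nat.exists_eq_succ_of_ne_zero hpos.ne'
      have hmin := Nat.find_min (exists_dyadic (R := R) (hq1 x.2)) (m := j') (by
        show j' < jOf x; omega)
      rw [hj']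
      exact not_lt.1 hmin
  have hj3 : ∀ x : Σ n : ℕ, Fin n → A, (cfQk x.2 x.1 : ℝ) ≤ R → jOf x ≤ Nat.log 2 ⌊R⌋₊ := by
    intro x hx
    have h := hj2 x hx
    have hpow : (2 : ℝ) ^ jOf x ≤ R := by
      rw [le_div_iff₀ (by positivity)] at h
      nlinarith [hq1 x.2, pow_pos (by norm_num : (0 : ℝ) < 2) (jOf x)]
    have hnat : 2 ^ jOf x ≤ ⌊R⌋₊ := by
      refine Nat.le_floor ?_
      exact_mod_cast hpow
    exact Nat.le_log_of_pow_le (by norm_num) hnat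
  -- the injection
  let Ψ : (Σ n : ℕ, Fin n → A) → (Σ j : ℕ, Σ n : ℕ, Fin n → A) := fun x =>
    ⟨jOf x, ⟨x.1 + 1, Fin.snoc x.2 b⟩⟩
  have hmaps : ∀ x ∈ cfWordsLE A N R,
      Ψ x ∈ (Finset.range (Nat.log 2 ⌊R⌋₊ + 1)).sigma fun j => cfSec A (R / 2 ^ j) (N + 1) := by
    intro x hx
    rw [mem_cfWordsLE] at hx
    have hxR : (cfQk x.2 x.1 : ℝ) ≤ R := hx.2
    simp only [Ψ, Finset.mem_sigma, Finset.mem_range, Nat.lt_succ_iff, mem_cfSec]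
    refine ⟨hj3 x hxR, by omega, ?_, ?_⟩
    · -- `q(w b) ≥ 2 q(w) > R/2^j`
      have hmul := mul_cfQk_le_cfQk_snoc x.2 b
      have hmul' : ((b : ℕ) : ℝ) * (cfQk x.2 x.1 : ℝ) ≤
          (cfQk (Fin.snoc x.2 b : Fin (x.1 + 1) → A) (x.1 + 1) : ℝ) := by exact_mod_cast hmul
      have hb2' : (2 : ℝ) ≤ ((b : ℕ) : ℝ) := by exact_mod_cast hb2
      have hlow := hj1 x
      rw [pow_succ, div_mul_eq_div_div, div_lt_iff₀ (by norm_num : (0 : ℝ) < 2)] at hlow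
      nlinarith [hq1 x.2]
    · intro k hk
      have hagree : ∀ i < x.1, cfDig (Fin.snoc x.2 b : Fin (x.1 + 1) → A) i = cfDig x.2 i :=
        fun i hi => cfDig_snoc_of_lt x.2 b hi
      rw [cfQk_eq_of_agree hagree (Nat.lt_succ_iff.1 hk)]
      have hmono : (cfQk x.2 k : ℝ) ≤ cfQk x.2 x.1 := by
        exact_mod_cast cfQk_mono hA x.2 (Nat.lt_succ_iff.1 hk)
      exact hmono.trans (hj2 x hxR)
  have hinj : Set.InjOn Ψ ↑(cfWordsLE A N R) := by
    rintro ⟨n, w⟩ _ ⟨n', w'⟩ _ hxy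
    simp only [Ψ] at hxy
    have h2' := congrArg (fun z : (Σ _ : ℕ, Σ k : ℕ, Fin k → A) => z.2) hxy
    simp only at h2'
    have hn : n = n' := by
      have := congrArg Sigma.fst h2'
      simp only at this
      omega
    subst hn
    have hw : (Fin.snoc w b : Fin (n + 1) → A) = Fin.snoc w' b := eq_of_heq (Sigma.mk.inj_iff.1 h2').2
    have : w = w' := by
      have h := congrArg Fin.init hw
      simpa only [Fin.init_snoc] using h
    subst this
    rfl
  have hcard := Finset.card_le_card_of_injOn Ψ hmaps hinj
  rw [Finset.card_sigma] at hcard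
  exact_mod_cast hcard

omit hA in
/-- The constant `16^δ ((B+1)²)^δ (1 - 4^{-δ})⁻¹` of the upper bound (`δ = δ_A`, `B = max A`).
[folklore] -/
def cfUpperConst : ℝ :=
  (16 : ℝ) ^ cfDimension A * ((((A.max' (nonempty_of_two_le_card h2) : ℝ) + 1) ^ 2) ^ cfDimension A) *
    (1 - ((4 : ℝ) ^ cfDimension A)⁻¹)⁻¹

/-- The constant is positive. [folklore] -/
theorem cfUpperConst_pos : 0 < cfUpperConst h2 := by
  have hδ0 : 0 < cfDimension A := cfDimension_pos hA h2
  have h4 : (1 : ℝ) < (4 : ℝ) ^ cfDimension A := Real.one_lt_rpow (by norm_num) hδ0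
  have : 0 < 1 - ((4 : ℝ) ^ cfDimension A)⁻¹ := by rw [sub_pos]; exact inv_lt_one_of_one_lt₀ h4
  unfold cfUpperConst
  positivity

/-- **Hensley's upper bound on short words:** for `R ≥ 1` and every `N`,
`#{w : |w| ≤ N, q(w) ≤ R} ≤ 16^δ ((B+1)²)^δ (1 - 4^{-δ})⁻¹ · R^{2δ}`, `δ = δ_A`, `B = max A`.
[folklore] -/
theorem card_cfWordsLE_le (N : ℕ) {R : ℝ} (hR : 1 ≤ R) :
    ((cfWordsLE A N R).card : ℝ) ≤ cfUpperConst h2 * (R ^ 2) ^ cfDimension A := by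
  have hne := nonempty_of_two_le_card h2
  unfold cfUpperConst
  set δ := cfDimension A with hδ
  set B : ℕ := A.max' hne with hBdef
  have hB : ∀ a ∈ A, a ≤ B := fun a ha => A.le_max' a ha
  have hδ0 : 0 < δ := cfDimension_pos hA h2
  have hZ1 : ∀ m, 1 ≤ cfPartition A m δ := fun m => (cfPartition_cfDimension_mem_Icc hA h2 m).1
  have hZ4 : ∀ m, cfPartition A m δ ≤ (4 : ℝ) ^ δ := fun m => (cfPartition_cfDimension_mem_Icc hA h2 m).2
  refine (card_cfWordsLE_le_sum hA h2 N hR).trans ?_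
  -- each dyadic section
  set J := Nat.log 2 ⌊R⌋₊ with hJ
  have hJR : (2 : ℝ) ^ J ≤ R := by
    have h1 : 2 ^ J ≤ ⌊R⌋₊ := Nat.pow_log_le_self 2 (Nat.floor_pos.2 hR).ne'
    have h2' : ((2 ^ J : ℕ) : ℝ) ≤ (⌊R⌋₊ : ℝ) := by exact_mod_cast h1
    push_cast at h2'
    exact h2'.trans (Nat.floor_le (by linarith))
  set r : ℝ := ((4 : ℝ) ^ δ)⁻¹ with hr
  have h4 : (1 : ℝ) < (4 : ℝ) ^ δ := Real.one_lt_rpow (by norm_num) hδ0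
  have hr0 : 0 ≤ r := by rw [hr]; positivity
  have hr1 : r < 1 := by rw [hr]; exact inv_lt_one_of_one_lt₀ h4
  set C : ℝ := (16 : ℝ) ^ δ * ((((B : ℝ) + 1) ^ 2) ^ δ) * (R ^ 2) ^ δ with hC
  have hterm : ∀ j ∈ Finset.range (J + 1),
      ((cfSec A (R / 2 ^ j) (N + 1)).card : ℝ) ≤ C * r ^ j := by
    intro j hj
    rw [Finset.mem_range, Nat.lt_succ_iff] at hj
    have hX : 1 ≤ R / 2 ^ j := by
      rw [le_div_iff₀ (by positivity), one_mul]
      exact (pow_le_pow_right₀ (by norm_num) hj).trans hJR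
    refine (card_cfSec_le hA hne hB hδ0.le hZ1 (hZ4 _) hX).trans (le_of_eq ?_)
    rw [hC, hr]
    have hBR : (0 : ℝ) ≤ (((B : ℝ) + 1) * R) ^ 2 := by positivity
    have e1 : (((B : ℝ) + 1) * (R / 2 ^ j)) ^ 2 = (((B : ℝ) + 1) ^ 2 * R ^ 2) / (4 : ℝ) ^ j := by
      rw [show (4 : ℝ) = 2 ^ 2 by norm_num, ← pow_mul, mul_comm 2 j, pow_mul]
      field_simp
    rw [e1, Real.div_rpow (by positivity) (by positivity), Real.mul_rpow (by positivity) (by positivity),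
      ← Real.rpow_natCast (4 : ℝ) j, ← Real.rpow_mul (by norm_num), mul_comm (j : ℝ) δ,
      Real.rpow_mul (by norm_num), Real.rpow_natCast, inv_pow]
    ring
  calc ∑ j ∈ Finset.range (J + 1), ((cfSec A (R / 2 ^ j) (N + 1)).card : ℝ)
      ≤ ∑ j ∈ Finset.range (J + 1), C * r ^ j := Finset.sum_le_sum hterm
    _ = C * ∑ j ∈ Finset.range (J + 1), r ^ j := by rw [Finset.mul_sum]
    _ ≤ C * (1 - r)⁻¹ := by
        refine mul_le_mul_of_nonneg_left ?_ (by rw [hC]; positivity)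
        have h := geom_sum_Ico_le_of_lt_one hr0 hr1 (m := 0) (n := J + 1)
        rw [pow_zero, ← Finset.range_eq_Ico] at h
        rwa [one_div] at h
    _ = (16 : ℝ) ^ δ * ((((B : ℝ) + 1) ^ 2) ^ δ) * (1 - r)⁻¹ * (R ^ 2) ^ δ := by rw [hC]; ring

end Dyadic

/-! ### From sections to elements of `Γ_A`: the lower bound -/

section Lower

variable (hA : ∀ a ∈ A, 1 ≤ a) (h2 : 2 ≤ A.card)
include hA h2

/-- The digit sequence of a word, padded by the letter `max A` (so that ALL digits lie in `A`).
[folklore] -/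
def cfPad (x : Σ n : ℕ, Fin n → A) : ℕ → ℕ :=
  fun i => if h : i < x.1 then ((x.2 ⟨i, h⟩ : A) : ℕ) else A.max' (nonempty_of_two_le_card h2)

omit hA in
/-- All padded digits lie in `A`. [folklore] -/
theorem cfPad_mem (x : Σ n : ℕ, Fin n → A) (i : ℕ) : cfPad h2 x i ∈ A := by
  unfold cfPad
  split_ifs with h
  · exact (x.2 _).2
  · exact Finset.max'_mem _ _

/-- All padded digits are `≥ 1`. [folklore] -/
theorem one_le_cfPad (x : Σ n : ℕ, Fin n → A) (i : ℕ) : 1 ≤ cfPad h2 x i := hA _ (cfPad_mem h2 x i)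

omit hA in
/-- Padded digits agree with the word's digits below its length. [folklore] -/
theorem cfPad_of_lt (x : Σ n : ℕ, Fin n → A) {i : ℕ} (hi : i < x.1) : cfPad h2 x i = cfDig x.2 i := by
  rw [cfDig_of_lt _ hi]
  simp [cfPad, hi]

/-- The even length `L(x) ∈ {n, n+1}` used to realise a section word in `Γ_A`. [folklore] -/
def cfEvenLen (x : Σ n : ℕ, Fin n → A) : ℕ := if Even x.1 then x.1 else x.1 + 1

omit hA h2 in
/-- `L(x)` is even. [folklore] -/
theorem even_cfEvenLen (x : Σ n : ℕ, Fin n → A) : Even (cfEvenLen x) := by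
  unfold cfEvenLen
  split_ifs with h
  · exact h
  · exact Nat.even_add_one.2 h

omit hA h2 in
/-- `n ≤ L(x) ≤ n + 1`. [folklore] -/
theorem le_cfEvenLen (x : Σ n : ℕ, Fin n → A) : x.1 ≤ cfEvenLen x ∧ cfEvenLen x ≤ x.1 + 1 := by
  unfold cfEvenLen
  split_ifs <;> omega

/-- The element of `SL₂(ℤ)` attached to a word: the word matrix of the padded word of even
length `L(x)`. [folklore] -/
def cfElt (x : Σ n : ℕ, Fin n → A) : SL(2, ℤ) :=
  ⟨cfWord (cfPad h2 x) (cfEvenLen x), by rw [det_cfWord, (even_cfEvenLen x).neg_one_pow]⟩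

omit hA in
/-- For a nonempty word, `cfElt x ∈ Γ_A`. [folklore] -/
theorem cfElt_mem {x : Σ n : ℕ, Fin n → A} (hx : 1 ≤ x.1) :
    ((cfElt h2 x : SL(2, ℤ)) : Matrix (Fin 2) (Fin 2) ℤ) ∈ cfSemigroup A := by
  show cfWord (cfPad h2 x) (cfEvenLen x) ∈ cfSemigroup A
  exact cfWord_mem_cfSemigroup (cfPad_mem h2 x) (by have := (le_cfEvenLen x).1; omega)
    (even_cfEvenLen x)

/-- The continuant of the realised word is at most `(B+1) q(w)`. [folklore] -/
theorem cfDen_cfPad_le (x : Σ n : ℕ, Fin n → A) :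
    (cfDen (cfPad h2 x) (cfEvenLen x) : ℝ) ≤
      ((A.max' (nonempty_of_two_le_card h2) : ℝ) + 1) * (cfQk x.2 x.1 : ℝ) := by
  have hne := nonempty_of_two_le_card h2
  set B := A.max' hne with hB
  have hd := one_le_cfPad hA h2 x
  have hdB : ∀ i, cfPad h2 x i ≤ B := fun i => A.le_max' _ (cfPad_mem h2 x i)
  have hqn : cfDen (cfPad h2 x) x.1 = cfQk x.2 x.1 := by
    simp only [cfQk, cfDen]
    rw [cfWord_congr fun i hi => cfPad_of_lt h2 x hi]
  have hB0 : (0 : ℝ) ≤ (B : ℝ) := Nat.cast_nonneg B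
  have hq0 : (0 : ℝ) ≤ (cfQk x.2 x.1 : ℝ) := by exact_mod_cast (zero_le_one.trans (one_le_cfQk hA x.2 _))
  unfold cfEvenLen
  split_ifs with h
  · rw [hqn]
    nlinarith
  · have := cfDen_succ_le hd hdB x.1
    rw [hqn] at this
    exact_mod_cast this

/-- **Section words realise distinct elements:** `cfElt` is injective on the section `S_X`
(uniqueness of stopping rules out a word being a padded proper prefix of another). [folklore] -/
theorem cfElt_injOn {X : ℝ} {N : ℕ} : Set.InjOn (cfElt h2) ↑(cfSec A X N) := by
  intro x hx y hy hxy
  rw [Finset.mem_coe, mem_cfSec] at hx hy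
  have hmat : cfWord (cfPad h2 x) (cfEvenLen x) = cfWord (cfPad h2 y) (cfEvenLen y) :=
    congrArg (fun γ : SL(2, ℤ) => (γ : Matrix (Fin 2) (Fin 2) ℤ)) hxy
  obtain ⟨hL, hdig⟩ := cfWord_injective (one_le_cfPad hA h2 x) (one_le_cfPad hA h2 y) hmat
  -- a common word of length `L` carrying both stops
  set L := cfEvenLen x with hLdef
  let z : Fin L → A := fun i => ⟨cfPad h2 x i, cfPad_mem h2 x i⟩
  have hzx : ∀ i < x.1, cfDig z i = cfDig x.2 i := fun i hi => by
    rw [cfDig_of_lt z (lt_of_lt_of_le hi (le_cfEvenLen x).1), ← cfPad_of_lt h2 x hi]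
  have hzy : ∀ i < y.1, cfDig z i = cfDig y.2 i := fun i hi => by
    have hiL : i < L := lt_of_lt_of_le hi (hL ▸ (le_cfEvenLen y).1)
    rw [cfDig_of_lt z hiL, ← cfPad_of_lt h2 y hi, ← hdig i hiL]
  have hsx : cfStop X z x.1 := (cfStop_iff_of_agree hzx).2 hx.2
  have hsy : cfStop X z y.1 := (cfStop_iff_of_agree hzy).2 hy.2
  have hn : x.1 = y.1 := cfStop_unique hsx hsy
  obtain ⟨n, w⟩ := x
  obtain ⟨n', w'⟩ := y
  simp only at hn
  subst hn
  have hww : w = w' := by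
    funext i
    apply Subtype.ext
    have e1 := hzx i i.2
    have e2 := hzy i i.2
    rw [e1, cfDig_of_lt _ i.2, cfDig_of_lt _ i.2] at e2
    exact e2
  subst hww
  rfl

/-- **The section injects into the ball:** for `R ≥ 2(B+1)²`, `X = R/(2(B+1)²)`, every `N`:
`#S_X^{≤N} ≤ #cfBall A R`. [folklore] -/
theorem card_cfSec_le_ncard_cfBall {R : ℝ}
    (hR : 2 * (((A.max' (nonempty_of_two_le_card h2) : ℝ) + 1) ^ 2) ≤ R) (N : ℕ) :
    (cfSec A (R / (2 * ((A.max' (nonempty_of_two_le_card h2) : ℝ) + 1) ^ 2)) N).card ≤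
      (cfBall A R).ncard := by
  have hne := nonempty_of_two_le_card h2
  set B := A.max' hne with hBdef
  have hB : ∀ a ∈ A, a ≤ B := fun a ha => A.le_max' a ha
  set X : ℝ := R / (2 * ((B : ℝ) + 1) ^ 2) with hX
  have hB1 : (0 : ℝ) < (B : ℝ) + 1 := by positivity
  have hX1 : 1 ≤ X := by rw [hX, le_div_iff₀ (by positivity)]; linarith
  rw [← Set.ncard_coe_finset]
  refine Set.ncard_le_ncard_of_injOn (cfElt h2) (fun x hx => ?_) (cfElt_injOn hA h2) (cfBall_finite A R)
  rw [Finset.mem_coe, mem_cfSec] at hx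
  have hn1 : 1 ≤ x.1 := cfStop_pos hX1 hx.2
  refine ⟨cfElt_mem h2 hn1, ?_, map_zmod_one_eq_one _⟩
  -- the norm: `‖M‖² ≤ 4 q² ≤ 4 ((B+1)² X)² = R²`
  have hqX : (cfQk x.2 x.1 : ℝ) ≤ ((B : ℝ) + 1) * X := cfQk_le_of_cfStop hA hB hne hX1 hx.2
  have hq : (cfDen (cfPad h2 x) (cfEvenLen x) : ℝ) ≤ ((B : ℝ) + 1) * (((B : ℝ) + 1) * X) :=
    (cfDen_cfPad_le hA h2 x).trans (mul_le_mul_of_nonneg_left hqX hB1.le)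
  have hq0 : (0 : ℝ) ≤ (cfDen (cfPad h2 x) (cfEvenLen x) : ℝ) := by
    exact_mod_cast (zero_le_one.trans (one_le_cfDen (one_le_cfPad hA h2 x) _))
  obtain ⟨m, hm⟩ : ∃ m, cfEvenLen x = m + 1 :=
    Nat.exists_eq_succ_of_ne_zero (by have := (le_cfEvenLen x).1; omega)
  have hnorm := normSq_cfWord_le (one_le_cfPad hA h2 x) m
  rw [← hm] at hnorm
  show (∑ i, ∑ j, ((cfWord (cfPad h2 x) (cfEvenLen x) i j : ℤ) : ℝ) ^ 2) ≤ R ^ 2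
  have hRX : R = 2 * ((B : ℝ) + 1) ^ 2 * X := by rw [hX]; field_simp
  refine hnorm.trans ?_
  rw [hRX]
  nlinarith [mul_nonneg hq0 hq0]

end Lower

/-! ### Hensley's theorem -/

/-- `(R²)^δ = R^{2δ}` for `R ≥ 0`. [folklore] -/
theorem sq_rpow_eq {R : ℝ} (hR : 0 ≤ R) (δ : ℝ) : (R ^ 2) ^ δ = R ^ (2 * δ) := by
  rw [Real.rpow_mul hR, Real.rpow_two]

section Main

variable (hA : ∀ a ∈ A, 1 ≤ a) (h2 : 2 ≤ A.card)
include hA h2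

/-- **Hensley's upper bound:** `#{γ ∈ Γ_A : ‖γ‖_F ≤ R} ≤ c₂ R^{2δ_A}` for all `R ≥ 1`.
[cite: MageeOhWinter2019, Thm. 2] -/
theorem cfCount_one_le : ∃ c₂ : ℝ, 0 < c₂ ∧ ∀ R : ℝ, 1 ≤ R →
    (cfCount A 1 1 R : ℝ) ≤ c₂ * R ^ (2 * cfDimension A) := by
  refine ⟨cfUpperConst h2, cfUpperConst_pos hA h2, fun R hR => ?_⟩
  obtain ⟨N, hN⟩ := pow_unbounded_of_one_lt (R ^ 2) (by norm_num : (1 : ℝ) < 2)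
  have h1 := ncard_cfBall_le_card hA (A := A) (by linarith) hN
  have h1' : (cfCount A 1 1 R : ℝ) ≤ ((cfWordsLE A N R).card : ℝ) := by
    rw [cfCount_one_eq]; exact_mod_cast h1
  refine h1'.trans ((card_cfWordsLE_le hA h2 N hR).trans (le_of_eq ?_))
  rw [sq_rpow_eq (by linarith) (cfDimension A)]

/-- **Hensley's lower bound:** `c₁ R^{2δ_A} ≤ #{γ ∈ Γ_A : ‖γ‖_F ≤ R}` for all `R ≥ R₀ = 2(B+1)²`
(`B = max A`; for small `R` the ball contains no element of `Γ_A`). [cite: MageeOhWinter2019, Thm. 2] -/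
theorem le_cfCount_one : ∃ R₀ : ℝ, 0 < R₀ ∧ ∃ c₁ : ℝ, 0 < c₁ ∧ ∀ R : ℝ, R₀ ≤ R →
    c₁ * R ^ (2 * cfDimension A) ≤ (cfCount A 1 1 R : ℝ) := by
  have hne := nonempty_of_two_le_card h2
  have hδ0 : 0 < cfDimension A := cfDimension_pos hA h2
  have hZ1 : ∀ m, 1 ≤ cfPartition A m (cfDimension A) := fun m =>
    (cfPartition_cfDimension_mem_Icc hA h2 m).1
  have hZ4 : ∀ m, cfPartition A m (cfDimension A) ≤ (4 : ℝ) ^ cfDimension A := fun m =>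
    (cfPartition_cfDimension_mem_Icc hA h2 m).2
  have hD0 : 0 < 2 * ((A.max' hne : ℝ) + 1) ^ 2 := by positivity
  refine ⟨2 * ((A.max' hne : ℝ) + 1) ^ 2, hD0,
    (4 : ℝ) ^ (-cfDimension A) * ((2 * ((A.max' hne : ℝ) + 1) ^ 2) ^ 2) ^ (-cfDimension A),
    by positivity, fun R hR => ?_⟩
  have hR0 : 0 < R := lt_of_lt_of_le hD0 hR
  have hX0 : 0 < R / (2 * ((A.max' hne : ℝ) + 1) ^ 2) := by positivity
  obtain ⟨N₀, hN₀⟩ := pow_unbounded_of_one_lt ((R / (2 * ((A.max' hne : ℝ) + 1) ^ 2)) ^ 2)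
    (by norm_num : (1 : ℝ) < 2)
  have hNX : (R / (2 * ((A.max' hne : ℝ) + 1) ^ 2)) ^ 2 < (2 : ℝ) ^ (N₀ + 1 - 1) := by
    rw [Nat.add_sub_cancel]; exact hN₀
  have hsec := le_card_cfSec hA hδ0.le hZ4 (hZ1 (N₀ + 1)) hX0 hNX
  have hball := card_cfSec_le_ncard_cfBall hA h2 hR (N₀ + 1)
  have hball' : ((cfSec A (R / (2 * ((A.max' hne : ℝ) + 1) ^ 2)) (N₀ + 1)).card : ℝ) ≤
      (cfCount A 1 1 R : ℝ) := by
    rw [cfCount_one_eq]; exact_mod_cast hball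
  refine le_trans (le_of_eq ?_) (hsec.trans hball')
  rw [div_pow, Real.div_rpow (by positivity) (by positivity), sq_rpow_eq hR0.le,
    Real.rpow_neg (by positivity : (0 : ℝ) ≤ (2 * ((A.max' hne : ℝ) + 1) ^ 2) ^ 2)]
  ring

/-- **Hensley's theorem (order of magnitude of the lattice-point count for `Γ_A`):** there are
`R₀, c₁, c₂ > 0` with `c₁ R^{2δ_A} ≤ #{γ ∈ Γ_A : ‖γ‖_F ≤ R} ≤ c₂ R^{2δ_A}` for all `R ≥ R₀`, where
`δ_A = cfDimension A` is the Hausdorff dimension of the limit set — the order of growth asserted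
(with an asymptotic constant and a power saving) by the `q = 1` case of
`MageeOhWinter2019_uniformCounting`. [cite: MageeOhWinter2019, Thm. 2] -/
theorem cfCount_one_asymp : ∃ R₀ : ℝ, 0 < R₀ ∧ ∃ c₁ : ℝ, 0 < c₁ ∧ ∃ c₂ : ℝ, 0 < c₂ ∧
    ∀ R : ℝ, R₀ ≤ R →
      c₁ * R ^ (2 * cfDimension A) ≤ (cfCount A 1 1 R : ℝ) ∧
        (cfCount A 1 1 R : ℝ) ≤ c₂ * R ^ (2 * cfDimension A) := by
  obtain ⟨R₀, hR₀, c₁, hc₁, hlow⟩ := le_cfCount_one hA h2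
  obtain ⟨c₂, hc₂, hup⟩ := cfCount_one_le hA h2
  refine ⟨max R₀ 1, by positivity, c₁, hc₁, c₂, hc₂, fun R hR => ⟨hlow R ?_, hup R ?_⟩⟩
  · exact (le_max_left _ _).trans hR
  · exact (le_max_right _ _).trans hR

end Main

end Literature.NumberTheory.Sieve
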